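import Literature.NumberTheory.EllipticCurves.Rank1Residual.Typed.SelmerCardCertificateRankZero
import Literature.NumberTheory.EllipticCurves.Rank1Residual.Typed.KolyvaginCertificate
import Literature.NumberTheory.EllipticCurves.Rank1Residual.Typed.X10
import Literature.NumberTheory.EllipticCurves.Rank1Residual.X10Proofs
import Literature.NumberTheory.EllipticCurves.MatarNekovar2019.ShaIndexBoundIrreducible
import Literature.NumberTheory.EllipticCurves.BSDQuadraticDescentTorsionOddPartProofs
import HarnessLib

/-!
# X10b RESISTANT list (`ord_3 #Ш_an = 2`): the exact `3`-part from Matar–Nekovář 2019 Thm. 0.3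
# (the Heegner-index BOUND over `K`, irreducible image) — the Cha-2005-free twin of
# `Typed/X10bHeegnerIndexCertificate.lean`

HONEST FRAMING (cell `b2b-bsdres`, run/shared/lean/b2b/bsd-rank1-residual/, verbatim in every
file): the goal of the cell is to DELETE the COMBINATION-SHAPED residual classes of the
Birch–Swinnerton-Dyer formula for ALL analytic-rank `≤ 1` elliptic curves over `ℚ` — "full BSD
formula for every rank `≤ 1` curve in class `C`" assembled STRICTLY from published theorems — so
that the rank-`≤ 1` remainder becomes exactly the CONSTRUCTION-SHAPED classes, which are TYPED
(missing-input `Prop`s), NOT attempted. This is not "finishing BSD". X10b REMAINS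
CONSTRUCTION-SHAPED; per curve; nothing is booked by this file.

Literature seat of the `pub-bsdpct` bundle (unit `pub-bsdpct-1`, gen 87). Theorems only (pure
compositions of tree theorems and of PUBLISHED named facts by name); no definition, no new named
fact (D-0026). Companion of `Rank1Residual/X9MatarNekovarCertificate.lean` (same seat: the
VANISHING case `p ∤ [E(K) : ℤ y_K]`, Matar–Nekovář Thm. 6.7 (1)).

## What is replaced, by what

`Typed/X10bHeegnerIndexCertificate.lean` (cell x10b) proves `BSD(E,3)` on the X10b RESISTANT list
(`p = 3` good ordinary, `E[3]` irreducible, `ρ̄_{E,3}` not surjective, analytic rank `0`,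
`ord_3 #Ш_an = 2`; census `N < 5·10⁵`: 22 isogeny classes, `10082b1` the one below `2·10⁴`) from
three inputs: the UPPER half `ord_3 #Ш(E/ℚ) ≤ 2·ord_3 [E(K) : ℤ y_K] ≤ 2` by **Cha 2005** (named fact
`Cha2005.thm52_padicValNat_shaOrder_le`, primary source NOT held — flag `Cha05-primary-unread`,
tier-affecting per REFEREE.md R170.3 / R171.3 for the record `(d25.1) 10082b1 @ 3`), the LOWER half
by the `3`-descent (`Sel^(3)(E/ℚ) ≠ 0`) and Cassels–Tate squareness, and GZK.

Here the upper half comes instead from **Matar–Nekovář, J. Théor. Nombres Bordeaux 31 (2019),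
Thm. 0.3 with §0.4, §0.11, Cor. 5.21 (e′), Prop. 5.26 (2)** (= Kolyvagin 1990 Cor. 13 under
IRREDUCIBILITY only; tree fact `MatarNekovar2019.thm03_padicValNat_card_sha_le_of_irreducible`,
held and READ; the certificate lane's row T-MN19, flag-free of record by REFEREE.md R178.3 (ii)):
for `d_K ∉ {−3, −4}`, `p ≠ 2`, `E[p]` irreducible, `y_K` of infinite order:
`ord_p #Ш(E/K) ≤ 2·ord_p [E(K) : ℤ y_K]`. That bound is over `K`; the step to `ℚ` is the
elementary `ord_p #Ш(E/ℚ) ≤ ord_p #Ш(E/K)` for `p` prime to `[K : ℚ]`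
(`padicValNat_shaOrder_le_baseChange_of_coprime`, this file: restriction `Ш(E/ℚ) → Ш(E/K)` is
injective on the `p`-primary part, `shaRestriction_eq_zero_iff_of_coprime`, and
`#A[p^∞] = p^{ord_p #A}`, `natCard_primaryComponent_eq_pow_padicValNat`), which needs `Ш(E/K)`
FINITE — Kolyvagin's Thm. A, the tree fact `kolyvagin N W K` (binder `hKo`; Gross 1991 Thm. 1.3).

Binder comparison with `bsdp_of_cha_of_casselsTate_of_dvd`: `hCha` ↦ (`hKo`, `hMN`); `¬ W.HasCM`,
`¬ p ∣ d_K`, `¬ p² ∣ N` DROPPED; `d_K ≠ −3`, `d_K ≠ −4` ADDED (Kolyvagin's standing `u_K = 1`; at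
`p = 3` the Cha binder `3 ∤ d_K` gives the first, and a Heegner field for an EVEN level has
`d_K ≠ −4` since `2` must split — both are read off the certificate's field anyway). Same index
certificate `ord_p [E(K) : ℤ y_K] ≤ k`, same descent line, same `#Ш_an`.

References: Matar–Nekovář 2019 [MatarNekovar2019]; Kolyvagin 1990 / Gross 1991 Thm. 1.3
[Gross1991]; Miller 2011 Def. 1.1, Thm. 5.2 [Miller2011LMS]; Silverman AEC X.4.14
[SilvermanAEC2009]; GJPST 2009 Prop. 3.35 (681b: the same "index + descent" combination)
[GrigorovJorzaPatrikisSteinTarnita2009]; RESIDUAL-CASES.md §a.2 X10, block (d25); REFEREE.md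
R170.3, R171.3, R178.3.
-/

noncomputable section

open scoped Classical

open WeierstrassCurve Literature.NumberTheory.EllipticCurves
  Literature.NumberTheory.EllipticCurves.Rank1Residual

/-! ### The odd part of `Ш` does not shrink under base change: `ord_p #Ш(E/ℚ) ≤ ord_p #Ш(E/K)` -/

namespace Literature.NumberTheory.EllipticCurves

/-- **`ord_p #Ш(E/F) ≤ ord_p #Ш(E/L)` for a Galois extension `L/F` of number fields and a prime `p`
prime to `[L : F]`, both groups finite.** The restriction `Ш(E/F) → Ш(E/L)` kills only
`[L : F]`-torsion (`shaRestriction_eq_zero_iff_of_coprime`, Serre, *Galois Cohomology* I.§2.4), so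
it is injective on the `p`-primary component, which it maps into the `p`-primary component of
`Ш(E/L)`; and `#A[p^∞] = p^{ord_p #A}` for a finite abelian group `A`
(`natCard_primaryComponent_eq_pow_padicValNat`). [cite: SerreGaloisCohomology1997, I.§2.4 Cor. to Prop. 9]
[cite: Matsuno2009, proof of Prop. 5.7 (the kernel of restriction is [K:ℚ]-torsion)] -/
theorem padicValNat_card_sha_le_baseChange_of_coprime {F : Type} [Field F] [NumberField F]
    (W : WeierstrassCurve F) [W.IsElliptic] (L : Type) [Field L] [NumberField L] [Algebra F L]
    [IsGalois F L] (p : ℕ) [Fact p.Prime] (hcop : p.Coprime (Module.finrank F L))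
    [Finite W.sha] [Finite (W.baseChange L).sha] :
    padicValNat p (Nat.card W.sha) ≤ padicValNat p (Nat.card (W.baseChange L).sha) := by
  have hp : p.Prime := Fact.out
  set A := AddCommGroup.primaryComponent W.sha p with hA
  set B := AddCommGroup.primaryComponent (W.baseChange L).sha p with hB
  have hmap : ∀ x : W.sha, x ∈ A → shaRestriction W L x ∈ B := by
    intro x hx
    obtain ⟨n, hn⟩ := (AddCommGroup.mem_primaryComponent).mp hx
    exact (AddCommGroup.mem_primaryComponent).mpr ⟨n, by rw [← map_nsmul, hn, map_zero]⟩
  let f : A → B := fun x ↦ ⟨shaRestriction W L x, hmap x x.2⟩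
  have hf : Function.Injective f := by
    rintro ⟨x, hx⟩ ⟨y, hy⟩ h
    have hxy : shaRestriction W L x = shaRestriction W L y := congrArg Subtype.val h
    have hsub : x - y ∈ A := A.sub_mem hx hy
    obtain ⟨n, hn⟩ := (AddCommGroup.mem_primaryComponent).mp hsub
    have h0 : shaRestriction W L (x - y) = 0 := by rw [map_sub, hxy, sub_self]
    have := (shaRestriction_eq_zero_iff_of_coprime W L (hcop.pow_left n) (x - y) hn).mp h0
    exact Subtype.ext (sub_eq_zero.mp this)
  have hcard : Nat.card A ≤ Nat.card B := Nat.card_le_card_of_injective f hf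
  rw [hA, hB, natCard_primaryComponent_eq_pow_padicValNat p,
    natCard_primaryComponent_eq_pow_padicValNat p] at hcard
  exact (Nat.pow_le_pow_iff_right hp.one_lt).mp hcard

/-- **Quadratic case over `ℚ`, odd `p`: `ord_p #Ш(E/ℚ) ≤ ord_p #Ш(E/K)`** (`K` imaginary quadratic,
both groups finite) — `shaOrder` phrasing. The companion identity
`#Ш(E/K)[p^∞] = #Ш(E/ℚ)[p^∞]·#Ш(E^{d_K}/ℚ)[p^∞]` (Jetchev–Skinner–Wan 2017 §7.4.1; tree
`WeierstrassCurve.card_primaryComponent_sha_baseChange_quadratic_of_odd_of_finite`) is not needed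
for the inequality. [cite: SerreGaloisCohomology1997, I.§2.4 Cor. to Prop. 9]
[cite: JetchevSkinnerWan2017, §7.4.1 (p. 30)] -/
theorem padicValNat_shaOrder_le_baseChange_of_odd (W : WeierstrassCurve ℚ) [W.IsElliptic]
    (K : Type) [Field K] [NumberField K] (hK : IsImaginaryQuadratic K) (p : ℕ) [Fact p.Prime]
    (hp2 : p ≠ 2) (hfin : W.ShaFinite) (hfinK : (W.baseChange K).ShaFinite) :
    padicValNat p W.shaOrder ≤ padicValNat p (Nat.card (W.baseChange K).sha) := by
  haveI : Finite W.sha := hfin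
  haveI : Finite (W.baseChange K).sha := hfinK
  haveI : IsGalois ℚ K := by
    haveI : Algebra.IsQuadraticExtension ℚ K := ⟨hK.1⟩
    infer_instance
  have hcop : p.Coprime (Module.finrank ℚ K) := by
    rw [hK.1]
    exact (Nat.coprime_primes (Fact.out : p.Prime) Nat.prime_two).mpr hp2
  exact padicValNat_card_sha_le_baseChange_of_coprime W K p hcop

end Literature.NumberTheory.EllipticCurves

namespace Literature.NumberTheory.EllipticCurves.Rank1Residual.Typed

section ClassFree

variable (W : WeierstrassCurve ℚ) [W.IsElliptic] (p : ℕ) [Fact p.Prime]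
  {N : ℕ} [NeZero N] {K : Type} [Field K] [NumberField K]

/-- **Kolyvagin's index bound over `ℚ`, irreducible image, from Matar–Nekovář Thm. 0.3.** For
`E/ℚ` of analytic rank `≤ 1` (GZK `hGZK`: `Ш(E/ℚ)` finite), `K` imaginary quadratic with the Heegner
hypothesis for the level `N` and `d_K ∉ {−3, −4}`, a Heegner point `P = y_K` of infinite order, and
an odd prime `p` with `E[p]` irreducible: `ord_p #Ш(E/ℚ) ≤ 2·ord_p [E(K) : ℤ P]`, from the bound
over `K` (`hMN`), finiteness of `Ш(E/K)` (Kolyvagin Thm. A, `hKo`) and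
`padicValNat_shaOrder_le_baseChange_of_odd`. The conclusion has the shape of Cha 2005 / Miller
Thm. 5.2 without `¬cm`, `p ∤ d_K`, `p² ∤ N`. [cite: MatarNekovar2019, Thm. 0.3 (p. 456), §0.4, §0.11 (p. 457)]
[cite: Gross1991, Thm. 1.3 (Kolyvagin: Ш(E/K) finite)] -/
theorem padicValNat_shaOrder_le_of_matarNekovar (hGZK : rank_eq_analyticRank_of_analyticRank_le_one)
    (hKo : kolyvagin N W K)
    (hMN : MatarNekovar2019.thm03_padicValNat_card_sha_le_of_irreducible N W K)
    (hr : W.analyticRank ≤ 1) (hK : IsImaginaryQuadratic K) (hH : SatisfiesHeegnerHypothesis N K)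
    (hD3 : NumberField.discr K ≠ -3) (hD4 : NumberField.discr K ≠ -4)
    {P : (W.baseChange K).toAffine.Point} (hP : IsHeegnerPoint N W K P) (hnt : ¬ IsOfFinAddOrder P)
    (hp2 : p ≠ 2) (hirr : Irr W p) :
    padicValNat p W.shaOrder ≤ 2 * padicValNat p (AddSubgroup.zmultiples P).index :=
  (padicValNat_shaOrder_le_baseChange_of_odd W K hK p hp2 (hGZK W hr).2 (hKo hK hH hP hnt).2).trans
    (hMN hK hH hD3 hD4 hP hnt Fact.out hp2 hirr)

/-- **The typed UPPER half from the Matar–Nekovář bound and an index certificate** (twin of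
`missingUpperBoundAt_of_cha_of_index_le`): if moreover `ord_p [E(K) : ℤ P] ≤ k` and `#Ш(E/ℚ)_an`
is a rational `q` with `2k ≤ ord_p q`, then `ord_p #Ш(E/ℚ) ≤ ord_p #Ш(E/ℚ)_an`
(`MissingUpperBoundAt W p`). [cite: MatarNekovar2019, Thm. 0.3 (p. 456) and §0.11 (p. 457)]
[cite: Miller2011LMS, Def. 1.1 (arXiv:1010.2431 p. 3)] -/
theorem missingUpperBoundAt_of_matarNekovar_of_index_le
    (hGZK : rank_eq_analyticRank_of_analyticRank_le_one) (hKo : kolyvagin N W K)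
    (hMN : MatarNekovar2019.thm03_padicValNat_card_sha_le_of_irreducible N W K)
    (hr : W.analyticRank ≤ 1) (hK : IsImaginaryQuadratic K) (hH : SatisfiesHeegnerHypothesis N K)
    (hD3 : NumberField.discr K ≠ -3) (hD4 : NumberField.discr K ≠ -4)
    {P : (W.baseChange K).toAffine.Point} (hP : IsHeegnerPoint N W K P) (hnt : ¬ IsOfFinAddOrder P)
    (hp2 : p ≠ 2) (hirr : Irr W p)
    {k : ℕ} (hI : padicValNat p (AddSubgroup.zmultiples P).index ≤ k)
    {q : ℚ} (hq : shaAn W = (q : ℂ)) (hv : (2 * k : ℤ) ≤ padicValRat p q) :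
    MissingUpperBoundAt W p := by
  have hle := padicValNat_shaOrder_le_of_matarNekovar W p hGZK hKo hMN hr hK hH hD3 hD4 hP hnt hp2 hirr
  refine ⟨q, hq, le_trans ?_ hv⟩
  have h1 : (padicValNat p W.shaOrder : ℤ) ≤
      2 * (padicValNat p (AddSubgroup.zmultiples P).index : ℤ) := by exact_mod_cast hle
  have h2 : (padicValNat p (AddSubgroup.zmultiples P).index : ℤ) ≤ k := by exact_mod_cast hI
  linarith

/-- **`BSD(E,p)` from the Matar–Nekovář upper bound and a lower certificate** (twin of
`bsdp_of_cha_of_casselsTate_of_dvd`), analytic rank `≤ 1`, odd `p`: granted GZK (`hGZK`),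
Cassels–Tate (`hCT`), Kolyvagin's finiteness (`hKo`) and Matar–Nekovář Thm. 0.3 (`hMN`), at a pair
with `#Ш(E/ℚ)_an = q`, `ord_p q = 2k`, a Heegner field (`d_K ∉ {−3,−4}`) and point with index
certificate `ord_p [E(K) : ℤ y_K] ≤ k`, `E[p]` irreducible, and the lower certificate
`p^{2k-1} ∣ #Ш(E/ℚ)`: Miller's `BSD(E,p)`. [cite: MatarNekovar2019, Thm. 0.3 and §0.11]
[cite: SilvermanAEC2009, Thm. X.4.14] [cite: Miller2011LMS, Def. 1.1] -/
theorem bsdp_of_matarNekovar_of_casselsTate_of_dvd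
    (hGZK : rank_eq_analyticRank_of_analyticRank_le_one)
    (hCT : exists_casselsTate_pairing (K := ℚ)) (hKo : kolyvagin N W K)
    (hMN : MatarNekovar2019.thm03_padicValNat_card_sha_le_of_irreducible N W K)
    (hr : W.analyticRank ≤ 1) (hK : IsImaginaryQuadratic K) (hH : SatisfiesHeegnerHypothesis N K)
    (hD3 : NumberField.discr K ≠ -3) (hD4 : NumberField.discr K ≠ -4)
    {P : (W.baseChange K).toAffine.Point} (hP : IsHeegnerPoint N W K P) (hnt : ¬ IsOfFinAddOrder P)
    (hp2 : p ≠ 2) (hirr : Irr W p)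
    {k : ℕ} (hI : padicValNat p (AddSubgroup.zmultiples P).index ≤ k)
    {q : ℚ} (hq : shaAn W = (q : ℂ)) (hv : padicValRat p q = 2 * k)
    (hdvd : p ^ (2 * k - 1) ∣ W.shaOrder) : BSDp W p :=
  bsdp_of_missingPPartAt W p hGZK hr
    (missingPPartAt_of_lower_of_upper W p
      (missingLowerBoundAt_of_casselsTate_of_pow_dvd W p hCT (hGZK W hr).2 hq hv.le hdvd)
      (missingUpperBoundAt_of_matarNekovar_of_index_le W p hGZK hKo hMN hr hK hH hD3 hD4 hP hnt hp2
        hirr hI hq hv.symm.le))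

/-- **The exact `p`-part under the same data: `ord_p #Ш(E/ℚ) = 2k`.** Lower: Cassels–Tate
squareness and `p^{2k-1} ∣ #Ш`; upper: Matar–Nekovář Thm. 0.3 moved to `ℚ` and the index
certificate. [cite: MatarNekovar2019, Thm. 0.3 and §0.11] [cite: SilvermanAEC2009, Thm. X.4.14] -/
theorem padicValNat_shaOrder_eq_of_matarNekovar_of_casselsTate_of_dvd
    (hGZK : rank_eq_analyticRank_of_analyticRank_le_one)
    (hCT : exists_casselsTate_pairing (K := ℚ)) (hKo : kolyvagin N W K)
    (hMN : MatarNekovar2019.thm03_padicValNat_card_sha_le_of_irreducible N W K)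
    (hr : W.analyticRank ≤ 1) (hK : IsImaginaryQuadratic K) (hH : SatisfiesHeegnerHypothesis N K)
    (hD3 : NumberField.discr K ≠ -3) (hD4 : NumberField.discr K ≠ -4)
    {P : (W.baseChange K).toAffine.Point} (hP : IsHeegnerPoint N W K P) (hnt : ¬ IsOfFinAddOrder P)
    (hp2 : p ≠ 2) (hirr : Irr W p)
    {k : ℕ} (hI : padicValNat p (AddSubgroup.zmultiples P).index ≤ k)
    (hdvd : p ^ (2 * k - 1) ∣ W.shaOrder) : padicValNat p W.shaOrder = 2 * k := by
  have hfin : W.ShaFinite := (hGZK W hr).2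
  have hsq : IsSquare W.shaOrder := isSquare_shaOrder_of_casselsTate hCT W hfin
  have hn : W.shaOrder ≠ 0 := (WeierstrassCurve.shaOrder_pos W hfin).ne'
  have hlow : 2 * k ≤ padicValNat p W.shaOrder :=
    two_mul_le_padicValNat_of_isSquare_of_pow_dvd hsq hn hdvd
  have hup := padicValNat_shaOrder_le_of_matarNekovar W p hGZK hKo hMN hr hK hH hD3 hD4 hP hnt hp2
    hirr
  omega

/-- **Rank `0`, native descent line** (twin of `bsdp_of_cha_of_casselsTate_of_selmerGroup_ne_bot`):
analytic rank `0`, `#Ш(E/ℚ)_an = q` with `ord_p q = 2`, `E[p]` irreducible, a Heegner field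
(`d_K ∉ {−3,−4}`) and point with index certificate `ord_p [E(K) : ℤ y_K] ≤ 1`, and
`Sel^(p)(E/ℚ) ≠ 0` (which IS `Ш(E)[p] ≠ 0` here: rank `0` by GZK, `p ∤ #E(ℚ)_tors` by
irreducibility) ⇒ `BSD(E,p)`. [cite: MatarNekovar2019, Thm. 0.3 and §0.11]
[cite: SilvermanAEC2009, Thm. X.4.14] [cite: Miller2011LMS, Def. 1.1] -/
theorem bsdp_of_matarNekovar_of_casselsTate_of_selmerGroup_ne_bot
    (hGZK : rank_eq_analyticRank_of_analyticRank_le_one)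
    (hCT : exists_casselsTate_pairing (K := ℚ)) (hKo : kolyvagin N W K)
    (hMN : MatarNekovar2019.thm03_padicValNat_card_sha_le_of_irreducible N W K)
    (hr : W.analyticRank = 0) (hK : IsImaginaryQuadratic K) (hH : SatisfiesHeegnerHypothesis N K)
    (hD3 : NumberField.discr K ≠ -3) (hD4 : NumberField.discr K ≠ -4)
    {P : (W.baseChange K).toAffine.Point} (hP : IsHeegnerPoint N W K P) (hnt : ¬ IsOfFinAddOrder P)
    (hp2 : p ≠ 2) (hirr : Irr W p)
    (hI : padicValNat p (AddSubgroup.zmultiples P).index ≤ 1)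
    {q : ℚ} (hq : shaAn W = (q : ℂ)) (hv : padicValRat p q = 2)
    (hSel : W.selmerGroup (p : ℤ) ≠ ⊥) : BSDp W p := by
  have hr1 : W.analyticRank ≤ 1 := by rw [hr]; norm_num
  have hrank : W.mordellWeilRank = 0 := by rw [(hGZK W hr1).1, hr]
  have htors : ¬ p ∣ W.torsionOrder := by
    intro hd
    have h0 := padicValNat_torsionOrder_eq_zero_of_irreducible W p hirr
    rw [padicValNat.eq_zero_iff] at h0
    rcases h0 with h | h | h
    · exact absurd h (Fact.out : p.Prime).one_lt.ne'
    · exact absurd h W.torsionOrder_pos_holds.ne'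
    · exact h hd
  have hdvd : p ∣ W.shaOrder :=
    dvd_shaOrder_of_exists_torsion W p
      (exists_sha_torsion_of_selmerGroup_ne_bot W p hSel hrank htors)
  exact bsdp_of_matarNekovar_of_casselsTate_of_dvd W p hGZK hCT hKo hMN hr1 hK hH hD3 hD4 hP hnt hp2
    hirr (k := 1) hI hq (by rw [hv]; norm_num) (by simpa using hdvd)

end ClassFree

/-! ### Class X10 at `p = 3`, rank `0`: the X10b RESISTANT list, Cha-free -/

section X10

variable (W : WeierstrassCurve ℚ) [W.IsElliptic] [W.IsGloballyMinimal]
  {N : ℕ} [NeZero N] {K : Type} [Field K] [NumberField K]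

/-- **X10 ∧ `r = 0` ∧ `ord_3 #Ш_an = 2`: `BSD(E,3)` from PUBLISHED theorems plus two finite
certificates, WITHOUT surjectivity of `ρ̄_{E,3}` and WITHOUT Cha 2005** (twin of
`X10.bsdp_three_rankZero_of_cha_of_selmerThree_ne_bot`). Named facts: GZK (`hGZK`), Cassels–Tate
(`hCT`), Kolyvagin's finiteness over `K` (`hKo`), Matar–Nekovář 2019 Thm. 0.3 (`hMN`; `irr(3)` is in
the class). Per-pair data: a Heegner field `K` for the level `N` with `d_K ∉ {−3, −4}` and Heegner
point `P = y_K` of infinite order with `ord_3 [E(K) : ℤ P] ≤ 1`; `#Ш(E/ℚ)_an = q`, `ord_3 q = 2`;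
the `3`-descent line `Sel^(3)(E/ℚ) ≠ 0`. Census: `(d25.1) 10082b1 @ 3` and the 21 further X10b
resistant classes of RESIDUAL-CASES (`N < 5·10⁵`). Per curve; NOT a class theorem.
[cite: MatarNekovar2019, Thm. 0.3 (p. 456), §0.4, §0.11 (p. 457)] [cite: SilvermanAEC2009, Thm. X.4.14]
[cite: Miller2011LMS, Def. 1.1] [cite: GrigorovJorzaPatrikisSteinTarnita2009, Prop. 3.35 (681b: the same combination)] -/
theorem X10.bsdp_three_rankZero_of_matarNekovar_of_selmerThree_ne_bot
    (hGZK : rank_eq_analyticRank_of_analyticRank_le_one)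
    (hCT : exists_casselsTate_pairing (K := ℚ)) [Fact (3 : ℕ).Prime] (hKo : kolyvagin N W K)
    (hMN : MatarNekovar2019.thm03_padicValNat_card_sha_le_of_irreducible N W K)
    (hX : ClassX10 W 3) (hr : W.analyticRank = 0)
    (hK : IsImaginaryQuadratic K) (hH : SatisfiesHeegnerHypothesis N K)
    (hD3 : NumberField.discr K ≠ -3) (hD4 : NumberField.discr K ≠ -4)
    {P : (W.baseChange K).toAffine.Point} (hP : IsHeegnerPoint N W K P) (hnt : ¬ IsOfFinAddOrder P)
    (hI : padicValNat 3 (AddSubgroup.zmultiples P).index ≤ 1)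
    {q : ℚ} (hq : shaAn W = (q : ℂ)) (hv : padicValRat 3 q = 2)
    (hSel : W.selmerGroup (3 : ℤ) ≠ ⊥) : BSDp W 3 :=
  bsdp_of_matarNekovar_of_casselsTate_of_selmerGroup_ne_bot W 3 hGZK hCT hKo hMN hr hK hH hD3 hD4 hP
    hnt (by decide) hX.2.2.1 hI hq hv (by exact_mod_cast hSel)

/-- **The exact `3`-part on such a pair: `ord_3 #Ш(E/ℚ) = 2`** (twin of
`X10.padicValNat_shaOrder_eq_two_of_cha_of_selmerThree_ne_bot`).
[cite: MatarNekovar2019, Thm. 0.3 and §0.11] [cite: SilvermanAEC2009, Thm. X.4.14] -/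
theorem X10.padicValNat_shaOrder_eq_two_of_matarNekovar_of_selmerThree_ne_bot
    (hGZK : rank_eq_analyticRank_of_analyticRank_le_one)
    (hCT : exists_casselsTate_pairing (K := ℚ)) [Fact (3 : ℕ).Prime] (hKo : kolyvagin N W K)
    (hMN : MatarNekovar2019.thm03_padicValNat_card_sha_le_of_irreducible N W K)
    (hX : ClassX10 W 3) (hr : W.analyticRank = 0)
    (hK : IsImaginaryQuadratic K) (hH : SatisfiesHeegnerHypothesis N K)
    (hD3 : NumberField.discr K ≠ -3) (hD4 : NumberField.discr K ≠ -4)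
    {P : (W.baseChange K).toAffine.Point} (hP : IsHeegnerPoint N W K P) (hnt : ¬ IsOfFinAddOrder P)
    (hI : padicValNat 3 (AddSubgroup.zmultiples P).index ≤ 1)
    (hSel : W.selmerGroup (3 : ℤ) ≠ ⊥) : padicValNat 3 W.shaOrder = 2 := by
  have hr1 : W.analyticRank ≤ 1 := by rw [hr]; norm_num
  have hrank : W.mordellWeilRank = 0 := by rw [(hGZK W hr1).1, hr]
  have htors : ¬ 3 ∣ W.torsionOrder := by
    intro hd
    have h0 := padicValNat_torsionOrder_eq_zero_of_irreducible W 3 hX.2.2.1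
    rw [padicValNat.eq_zero_iff] at h0
    rcases h0 with h | h | h
    · exact absurd h (by norm_num)
    · exact absurd h W.torsionOrder_pos_holds.ne'
    · exact h hd
  have hdvd : 3 ∣ W.shaOrder :=
    dvd_shaOrder_of_exists_torsion W 3
      (exists_sha_torsion_of_selmerGroup_ne_bot W 3 (by exact_mod_cast hSel) hrank htors)
  simpa using padicValNat_shaOrder_eq_of_matarNekovar_of_casselsTate_of_dvd W 3 hGZK hCT hKo hMN hr1
    hK hH hD3 hD4 hP hnt (by decide) hX.2.2.1 (k := 1) hI (by simpa using hdvd)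

/-- **Discharging the typed missing input of `Typed/X10.lean`** at such a pair, Cha-free:
`X10.MissingInputAt W`. Per curve; bookkeeping. [cite: MatarNekovar2019, Thm. 0.3 and §0.11]
[cite: Miller2011LMS, Def. 1.1] -/
theorem X10.missingInputAt_of_matarNekovar_of_selmerThree_ne_bot
    (hGZK : rank_eq_analyticRank_of_analyticRank_le_one)
    (hCT : exists_casselsTate_pairing (K := ℚ)) [Fact (3 : ℕ).Prime] (hKo : kolyvagin N W K)
    (hMN : MatarNekovar2019.thm03_padicValNat_card_sha_le_of_irreducible N W K)
    (hX : ClassX10 W 3) (hr : W.analyticRank = 0)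
    (hK : IsImaginaryQuadratic K) (hH : SatisfiesHeegnerHypothesis N K)
    (hD3 : NumberField.discr K ≠ -3) (hD4 : NumberField.discr K ≠ -4)
    {P : (W.baseChange K).toAffine.Point} (hP : IsHeegnerPoint N W K P) (hnt : ¬ IsOfFinAddOrder P)
    (hI : padicValNat 3 (AddSubgroup.zmultiples P).index ≤ 1)
    {q : ℚ} (hq : shaAn W = (q : ℂ)) (hv : padicValRat 3 q = 2)
    (hSel : W.selmerGroup (3 : ℤ) ≠ ⊥) : X10.MissingInputAt W := fun _ =>
  haveI : Finite W.sha := (hGZK W hX.analyticRank_le_one).2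
  missingPPartAt_of_bsdp W 3
    (X10.bsdp_three_rankZero_of_matarNekovar_of_selmerThree_ne_bot W hGZK hCT hKo hMN hX hr hK hH hD3
      hD4 hP hnt hI hq hv hSel)

end X10

end Literature.NumberTheory.EllipticCurves.Rank1Residual.Typed

end
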